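import Literature.NumberTheory.Automorphic.WhittakerBiEquivariantSupport
import Literature.NumberTheory.Automorphic.ThinTestFunction
import Literature.NumberTheory.Automorphic.RankinSelbergTorusEulerExact
import HarnessLib

/-!
# The thin torus integrand is supported on units at the thin places

Topic `NumberTheory/Automorphic`; namespace `Literature.NumberTheory.Automorphic`. The finite-place
half, in every rank, of the reduction of the named fact `JacquetShalika1981_partialPairL_pole_of_eq_conj`
(`PairLFunctionPoles`; Arthur–Clozel (1989), Ch. 3 (2.3)) to an archimedean statement: the hypothesis
`hfin` of `JacquetShalika1981_partialPairL_pole_of_eq_conj_of_thinFirstMoment`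
(`PairLFunctionPolesEqConjThinFirstMoment`) asks for the finiteness of
`∫⁻_{B({v ∉ T}) × K} |W(diag(a) k)|² Φ(e_n diag(a) k) |det a| δ_B(a)⁻¹` for the thin test function
`Φ = thinTestFun n K Φ_∞ T m`. This file shows that, for a function `W` which at every `v ∈ T` is a
"spread bi-equivariant" Whittaker function in the sense of `WhittakerBiEquivariantSupport`
(left `ψ`-equivariant under `N_n(𝔸_K)`, right `ψ_v`-equivariant under `ι_v(N_n(K_v) ∩ d GL_n(𝒪_v) d⁻¹)`,
right invariant under `ι_v(d K_v(𝔭^M) d⁻¹)`, with a unitary central character), the integrand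
VANISHES unless all the entries of `a` are units at every `v ∈ T`
(`valued_eq_one_of_torusIntegrand_thin_ne_zero`): the thin test function forces `|a_{n-1}|_v = 1` and
`e_n k_v ≡ (0, …, 0, *) (mod 𝔭_v^m)`, and then the torus form of the support theorem
(`WhittakerSupport.valuation_eq_of_glDiagonal_mul_ne_zero`) applied to `g_v ↦ W(g^{(v)} ι_v(g_v))`
gives `|a_i|_v = |a_{n-1}|_v`. Consequently (`setLIntegral_torusIntegrand_thin_le`)

  `∫⁻_{B({v ∉ T}) × K} (thin integrand) ≤ ∫⁻_{B(all finite places) × K} (standard integrand)`,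

an integral over the ARCHIMEDEAN torus times the maximal compact subgroup only. All proofs complete;
no named fact (the printed device: Jacquet–Piatetski-Shapiro–Shalika (1983), (2.7); Jacquet–Shalika
(1981), §4, (5.1)).

## References

* H. Jacquet, I. I. Piatetski-Shapiro, J. A. Shalika, *Rankin–Selberg convolutions*, Amer. J. Math.
  105 (1983), §2, (2.7) [JacquetPiatetskiShapiroShalika1983].
* H. Jacquet, J. A. Shalika, *On Euler products and the classification of automorphic
  representations I*, Amer. J. Math. 103 (1981), §4, (5.1) [JacquetShalikaAJM1981].
-/

noncomputable section

open MeasureTheory Measure NumberField IsDedekindDomain Matrix Set WithZero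
open scoped MatrixGroups ENNReal NNReal
open Literature.NumberTheory.GaloisRepresentations (ideleGroup localUnits)

namespace Literature.NumberTheory.Automorphic

/-! ### The hypotheses at a finite place -/

section Local

open ValuativeRel

variable {N : ℕ} {K : Type} [Field K] [NumberField K] (v : HeightOneSpectrum (𝓞 K))

/-- **`W` is a spread bi-equivariant Whittaker function at the finite place `v`** for the global
character `ψ`, the torus parameters `t : Fin N → K_vˣ` and the level exponent `M`: right
multiplication by `ι_v(u)`, `u ∈ N_N(K_v)` with `|u_{ij} t_j|_v ≤ |t_i|_v`, multiplies `W` by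
`(ψ_v)_N(u)`, and right multiplication by `ι_v(κ)` with `|(κ - 1)_{ij} t_j|_v ≤ exp(-M) |t_i|_v` fixes
`W` (the global form of `WhittakerSupport.IsSpreadWhittaker`). [folklore] -/
structure IsSpreadWhittakerAt (ψ : AddChar (AdeleRing (𝓞 K) K) Circle) (t : Fin N → (v.adicCompletion K)ˣ)
    (M : ℤ) (W : GL (Fin N) (AdeleRing (𝓞 K) K) → ℂ) : Prop where
  /-- `W(g ι_v(u)) = (ψ_v)_N(u) W(g)` for `u ∈ N_N(K_v)` with `d⁻¹ u d` integral. -/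
  right : ∀ (u : GL (Fin N) (v.adicCompletion K)) (hu : u ∈ upperUnitriangular (Fin N) (v.adicCompletion K)),
    (∀ i j, Valued.v ((u : Matrix (Fin N) (Fin N) (v.adicCompletion K)) i j * t j) ≤ Valued.v (t i : v.adicCompletion K)) →
    ∀ g : GL (Fin N) (AdeleRing (𝓞 K) K),
      W (g * GLn.ofLocal N K v u) = whittakerCharFun (ψ.adicComponent v) ⟨u, hu⟩ * W g
  /-- `W(g ι_v(κ)) = W(g)` for `κ` with `d⁻¹ κ^{±1} d ≡ 1 (mod 𝔭^M)`. -/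
  level : ∀ κ : GL (Fin N) (v.adicCompletion K),
    (∀ i j, Valued.v (((κ : Matrix (Fin N) (Fin N) (v.adicCompletion K)) - 1) i j * t j) ≤
      exp (-M) * Valued.v (t i : v.adicCompletion K)) →
    (∀ i j, Valued.v ((((κ⁻¹ : GL (Fin N) (v.adicCompletion K)) : Matrix (Fin N) (Fin N) (v.adicCompletion K)) - 1) i j * t j) ≤
      exp (-M) * Valued.v (t i : v.adicCompletion K)) →
    ∀ g : GL (Fin N) (AdeleRing (𝓞 K) K), W (g * GLn.ofLocal N K v κ) = W g

variable {v}

/-- Local diagonal matrices: `glDiagonal = diagonalGL` (two spellings in the tree). [folklore] -/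
theorem glDiagonal_eq_diagonalGL (d : Fin N → (v.adicCompletion K)ˣ) :
    glDiagonal N (v.adicCompletion K) d = diagonalGL (Fin N) (v.adicCompletion K) d :=
  Matrix.GeneralLinearGroup.ext fun i j => by rw [coe_glDiagonal, coe_diagonalGL]

/-- `diag(z, …, z) = z · 1` in `GL_N`. [folklore] -/
theorem glDiagonal_const_eq_scalar {R : Type*} [CommRing R] (z : Rˣ) :
    glDiagonal N R (fun _ => z) = Matrix.GeneralLinearGroup.scalar (Fin N) z :=
  Matrix.GeneralLinearGroup.ext fun i j => by
    rw [coe_glDiagonal, Matrix.GeneralLinearGroup.coe_scalar, Matrix.scalar_apply]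

/-- `ι_v(diag(z, …, z))` is the global scalar matrix of the idele `localUnits v z`. [folklore] -/
theorem ofLocal_glDiagonal_const (z : (v.adicCompletion K)ˣ) :
    GLn.ofLocal N K v (glDiagonal N (v.adicCompletion K) fun _ => z) =
      Matrix.GeneralLinearGroup.scalar (Fin N) (localUnits v z) := by
  rw [glDiagonal_eq_diagonalGL, GLn.ofLocal_diagonalGL, glDiagonal_const_eq_scalar]

/-- **The local datum `g_v ↦ W(g' ι_v(g_v))` is a spread bi-equivariant Whittaker function on
`GL_N(K_v)`** (`WhittakerSupport.IsSpreadWhittaker`) whenever `W` is left `ψ`-equivariant under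
`N_N(𝔸_K)`, spread bi-equivariant at `v`, and `g'` has trivial `v`-component (so that it commutes with
`ι_v(GL_N(K_v))`, `GLn.ofLocal_mul_eq_mul_ofLocal_of_toLocal_eq_one`). [folklore] -/
theorem isSpreadWhittaker_ofLocal {ψ : AddChar (AdeleRing (𝓞 K) K) Circle}
    {t : Fin N → (v.adicCompletion K)ˣ} {M : ℤ} {W : GL (Fin N) (AdeleRing (𝓞 K) K) → ℂ}
    (hWN : ∀ (u : ↥(adelicUnipotent N K)) (g : GL (Fin N) (AdeleRing (𝓞 K) K)),
      W ((u : GL (Fin N) (AdeleRing (𝓞 K) K)) * g) = whittakerCharFun ψ u * W g)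
    (hW : IsSpreadWhittakerAt v ψ t M W) {g' : GL (Fin N) (AdeleRing (𝓞 K) K)}
    (hg' : localComponent v g' = 1) :
    WhittakerSupport.IsSpreadWhittaker (ψ.adicComponent v) t M (fun h => W (g' * GLn.ofLocal N K v h)) := by
  refine ⟨fun u hu h => ?_, fun u hu hbd h => ?_, fun κ hκ hκ' h => ?_⟩
  · rw [map_mul, ← mul_assoc, ← GLn.ofLocal_mul_eq_mul_ofLocal_of_toLocal_eq_one u hg', mul_assoc]
    have := hWN ⟨GLn.ofLocal N K v u, ofLocal_mem_adelicUnipotent hu⟩ (g' * GLn.ofLocal N K v h)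
    rw [this, whittakerCharFun_ofLocal ψ ⟨u, hu⟩]
  · rw [map_mul, ← mul_assoc]
    exact hW.right u hu hbd _
  · rw [map_mul, ← mul_assoc]
    exact hW.level κ hκ hκ' _

/-- The central insensitivity of the local datum: if `‖W(z g)‖ = ‖W(g)‖` for global scalars `z`, then
`W(g' ι_v(h)) ≠ 0 → W(g' ι_v(diag(z) h)) ≠ 0` for local scalars `z`. [folklore] -/
theorem ofLocal_scalar_ne_zero {W : GL (Fin N) (AdeleRing (𝓞 K) K) → ℂ}
    (hWZ : ∀ (z : ideleGroup K) (g : GL (Fin N) (AdeleRing (𝓞 K) K)),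
      ‖W (Matrix.GeneralLinearGroup.scalar (Fin N) z * g)‖ = ‖W g‖)
    (g' : GL (Fin N) (AdeleRing (𝓞 K) K)) (z : (v.adicCompletion K)ˣ) (h : GL (Fin N) (v.adicCompletion K))
    (hne : W (g' * GLn.ofLocal N K v h) ≠ 0) :
    W (g' * GLn.ofLocal N K v (glDiagonal N (v.adicCompletion K) (fun _ => z) * h)) ≠ 0 := by
  rw [map_mul, ofLocal_glDiagonal_const, ← mul_assoc,
    ← Matrix.GeneralLinearGroup.scalar_commute (localUnits v z) g', mul_assoc]
  intro h0
  apply hne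
  have := hWZ (localUnits v z) (g' * GLn.ofLocal N K v h)
  rw [h0, norm_zero] at this
  exact norm_eq_zero.1 this.symm

end Local

/-! ### The pointwise support statement -/

section Pointwise

open ValuativeRel

variable {n : ℕ} {K : Type} [Field K] [NumberField K] {v : HeightOneSpectrum (𝓞 K)}

/-- The last row of `g ∈ GL_{n+1}` is its row `n`. [folklore] -/
theorem lastRow_succ_apply (g : GL (Fin (n + 1)) (AdeleRing (𝓞 K) K)) (j : Fin (n + 1)) :
    lastRow (n + 1) K g j = (g : Matrix (Fin (n + 1)) (Fin (n + 1)) (AdeleRing (𝓞 K) K)) (Fin.last n) j := by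
  rw [lastRow, Matrix.vecMul, dotProduct, Finset.sum_eq_single (Fin.last n)]
  · simp only [lastBasisVec, Fin.val_last, if_true, one_mul]
  · intro i _ hi
    simp only [lastBasisVec]
    rw [if_neg, zero_mul]
    intro h
    exact hi (Fin.ext (by simp only [Fin.val_last]; omega))
  · intro h
    exact absurd (Finset.mem_univ _) h

/-- Entrywise maps of diagonal matrices (the statement of `generalLinearGroup_map_glDiagonal` of
`CornerTorusIwasawaData`, not imported here). [folklore] -/
private theorem map_glDiagonal_aux {R S : Type*} [CommRing R] [CommRing S] (f : R →+* S) (d : Fin (n + 1) → Rˣ) :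
    Matrix.GeneralLinearGroup.map f (glDiagonal (n + 1) R d) =
      glDiagonal (n + 1) S fun i => Units.map f.toMonoidHom (d i) := by
  refine Matrix.GeneralLinearGroup.ext fun i j => ?_
  change f ((glDiagonal (n + 1) R d : Matrix (Fin (n + 1)) (Fin (n + 1)) R) i j) = _
  rw [coe_glDiagonal, coe_glDiagonal, Matrix.diagonal_apply, Matrix.diagonal_apply]
  split_ifs
  · rfl
  · exact map_zero f

/-- **The thin congruence at `v` forces `|a_n|_v = 1` and `e_{n+1} k_v ≡ (0, …, 0, *) (mod 𝔭_v^m)`.** For a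
torus point `diag(a) k` (`a ∈ (𝔸_Kˣ)^{n+1}`, `k ∈ K`) at which the thin test function of depth `m ≥ 1`
does not vanish and `v ∈ T`: the last entry of `a` is a unit at `v` and the off-diagonal entries of the
last row of the `v`-component of `k` have valuation `≤ exp(-m)`. [folklore] -/
theorem valued_last_eq_one_and_lastRow_le_of_thinTestFun_ne_zero
    {Φinf : (Fin (n + 1) → InfiniteAdeleRing K) → ℝ} {T : Finset (HeightOneSpectrum (𝓞 K))} {m : ℕ}
    (hm : 1 ≤ m) (hv : v ∈ T) (a : Fin (n + 1) → ideleGroup K) (k : ↥(maximalCompactAdelic (n + 1) K))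
    (hΦ : thinTestFun (n + 1) K Φinf T m (lastRow (n + 1) K (torusPoint (n + 1) K (a, k))) ≠ 0) :
    Valued.v (((a (Fin.last n) : ideleGroup K) : AdeleRing (𝓞 K) K).2 v) = 1 ∧
      ∀ j : Fin (n + 1), j ≠ Fin.last n →
        Valued.v (((localComponent v (show GL (Fin (n + 1)) (AdeleRing (𝓞 K) K) from
          (k : (AdelicGroupData.gl (n + 1) K).Adelic)) : GL (Fin (n + 1)) (v.adicCompletion K)) :
            Matrix (Fin (n + 1)) (Fin (n + 1)) (v.adicCompletion K)) (Fin.last n) j) ≤ exp (-(m : ℤ)) := by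
  set kG : GL (Fin (n + 1)) (AdeleRing (𝓞 K) K) :=
    (show GL (Fin (n + 1)) (AdeleRing (𝓞 K) K) from (k : (AdelicGroupData.gl (n + 1) K).Adelic)) with hkG
  set kv : GL (Fin (n + 1)) (v.adicCompletion K) := localComponent v kG with hkv
  set α : v.adicCompletion K := ((a (Fin.last n) : ideleGroup K) : AdeleRing (𝓞 K) K).2 v with hα
  set r : Fin (n + 1) → v.adicCompletion K := fun j =>
    ((kv : GL (Fin (n + 1)) (v.adicCompletion K)) : Matrix (Fin (n + 1)) (Fin (n + 1)) (v.adicCompletion K))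
      (Fin.last n) j with hr
  -- the thin congruence, read on the components
  have hcong : ∀ j : Fin (n + 1), Valued.v (α * r j - if j = Fin.last n then 1 else 0) ≤ exp (-(m : ℤ)) := by
    intro j
    have h := thinTestFun_ne_zero_valued_sub_le hΦ hv j
    have hlastEntry : lastEntry a = a (Fin.last n) := by
      rw [lastEntry, dif_pos (Nat.succ_pos n)]
      rfl
    have hrow : (lastRow (n + 1) K (torusPoint (n + 1) K (a, k)) j).2 v = α * r j := by
      rw [torusPoint, lastRow_glDiagonal_mul, Pi.smul_apply, smul_eq_mul, hlastEntry]
      change (AdelicGroupData.adeleEval K v) (((a (Fin.last n) : ideleGroup K) : AdeleRing (𝓞 K) K) *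
        lastRow (n + 1) K kG j) = α * r j
      rw [map_mul, lastRow_succ_apply]
      rfl
    rw [hrow] at h
    have hiff : ((j : ℕ) + 1 = n + 1) ↔ j = Fin.last n :=
      ⟨fun h' => Fin.ext (by rw [Fin.val_last]; omega), fun h' => by rw [h', Fin.val_last]⟩
    by_cases hj : j = Fin.last n
    · rw [if_pos hj]
      rw [if_pos (hiff.2 hj)] at h
      exact h
    · rw [if_neg hj]
      rw [if_neg (fun h' => hj (hiff.1 h'))] at h
      exact h
  have hexpm : exp (-(m : ℤ)) < (1 : ℤᵐ⁰) := by rw [← exp_zero, exp_lt_exp]; omega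
  -- primitivity and integrality of the last row of `k_v ∈ GL_{n+1}(𝒪_v)`
  have hkint : kv ∈ glInt (n + 1) (v.adicCompletion K) :=
    localComponent_mem_glInt_of_mem_maximalCompactAdelic k.2
  obtain ⟨j₀, hj₀⟩ := exists_valued_entry_eq_one_of_mem_glInt hkint (Fin.last n)
  have hrint : ∀ j, Valued.v (r j) ≤ 1 := fun j =>
    (mem_integer_adicCompletion_iff K v).1 (((mem_glInt_iff _).1 hkint).1 (Fin.last n) j)
  -- `|α|_v = 1`
  have hα1 : Valued.v α = 1 := by
    by_cases hj : j₀ = Fin.last n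
    · -- the corner entry is a unit: `|α r - 1| < 1` forces `|α r| = 1`
      have h1 := hcong (Fin.last n)
      rw [if_pos rfl] at h1
      rw [hj] at hj₀
      have hlt : Valued.v (α * r (Fin.last n) - 1) < 1 := h1.trans_lt hexpm
      have heq : Valued.v (1 + (α * r (Fin.last n) - 1)) = 1 := Valuation.map_one_add_of_lt _ hlt
      rw [add_sub_cancel, Valuation.map_mul, hj₀, mul_one] at heq
      exact heq
    · -- a unit entry off the corner would make `α` small, and then `|α r_n - 1| = 1`
      exfalso
      have h1 := hcong j₀
      rw [if_neg hj, sub_zero, Valuation.map_mul, hj₀, mul_one] at h1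
      have hαlt : Valued.v α < 1 := h1.trans_lt hexpm
      have h2 := hcong (Fin.last n)
      rw [if_pos rfl] at h2
      have hsmall : Valued.v (α * r (Fin.last n)) < 1 := by
        rw [Valuation.map_mul]
        calc Valued.v α * Valued.v (r (Fin.last n)) ≤ Valued.v α * 1 := mul_le_mul_right (hrint _) _
          _ < 1 := by rwa [mul_one]
      have hone : Valued.v (α * r (Fin.last n) - 1) = 1 := by
        rw [sub_eq_add_neg, add_comm, Valuation.map_add_eq_of_lt_left]
        · rw [Valuation.map_neg, Valuation.map_one]
        · rwa [Valuation.map_neg, Valuation.map_one]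
      rw [hone] at h2
      exact absurd h2 (not_le.2 hexpm)
  refine ⟨hα1, fun j hj => ?_⟩
  have h := hcong j
  rw [if_neg hj, sub_zero, Valuation.map_mul, hα1, one_mul] at h
  exact h

/-- **The thin torus integrand is supported on units at the thin places.** Let `W : GL_{n+1}(𝔸_K) → ℂ`
be left `ψ`-equivariant under `N_{n+1}(𝔸_K)`, with `‖W(z g)‖ = ‖W(g)‖` for scalar ideles `z`, and at the
place `v ∈ T` spread bi-equivariant (`IsSpreadWhittakerAt`) for parameters `t`, `M` with
`ψ_v` non-trivial somewhere on `{|x| ≤ exp(1 - c₀)}`, `M ≥ 1`, `|t_j| ≤ |t_i|` (`i ≤ j`), gaps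
`exp(M - c₀)|t_{i+1}| ≤ |t_i|` and `exp(-m)|t_0| ≤ exp(-M)|t_n|` (`m ≥ 1`). If at the torus point
`diag(a) k` both `W` and the thin test function `thinTestFun Φ_∞ T m ∘ e_{n+1}` are non-zero, then every
entry of `a` is a unit at `v`. [folklore] -/
theorem valued_eq_one_of_torusIntegrand_thin_ne_zero
    {ψ : AddChar (AdeleRing (𝓞 K) K) Circle} {W : GL (Fin (n + 1)) (AdeleRing (𝓞 K) K) → ℂ}
    (hWN : ∀ (u : ↥(adelicUnipotent (n + 1) K)) (g : GL (Fin (n + 1)) (AdeleRing (𝓞 K) K)),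
      W ((u : GL (Fin (n + 1)) (AdeleRing (𝓞 K) K)) * g) = whittakerCharFun ψ u * W g)
    (hWZ : ∀ (z : ideleGroup K) (g : GL (Fin (n + 1)) (AdeleRing (𝓞 K) K)),
      ‖W (Matrix.GeneralLinearGroup.scalar (Fin (n + 1)) z * g)‖ = ‖W g‖)
    {t : Fin (n + 1) → (v.adicCompletion K)ˣ} {M c₀ : ℤ} (hW : IsSpreadWhittakerAt v ψ t M W)
    (hψv : ∃ x : v.adicCompletion K, Valued.v x ≤ exp (1 - c₀) ∧ ψ.adicComponent v x ≠ 1) (hM₁ : 1 ≤ M)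
    (hmono : ∀ i j : Fin (n + 1), i ≤ j → Valued.v (t j : v.adicCompletion K) ≤ Valued.v (t i : v.adicCompletion K))
    (hgap : ∀ i j : Fin (n + 1), (i : ℕ) + 1 = j →
      exp (M - c₀) * Valued.v (t j : v.adicCompletion K) ≤ Valued.v (t i : v.adicCompletion K))
    {m : ℕ} (hm : 1 ≤ m)
    (hmt : exp (-(m : ℤ)) * Valued.v (t 0 : v.adicCompletion K) ≤
      exp (-M) * Valued.v (t (Fin.last n) : v.adicCompletion K))
    {Φinf : (Fin (n + 1) → InfiniteAdeleRing K) → ℝ} {T : Finset (HeightOneSpectrum (𝓞 K))} (hv : v ∈ T)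
    (a : Fin (n + 1) → ideleGroup K) (k : ↥(maximalCompactAdelic (n + 1) K))
    (hWne : W (torusPoint (n + 1) K (a, k)) ≠ 0)
    (hΦ : thinTestFun (n + 1) K Φinf T m (lastRow (n + 1) K (torusPoint (n + 1) K (a, k))) ≠ 0)
    (i : Fin (n + 1)) : Valued.v (((a i : ideleGroup K) : AdeleRing (𝓞 K) K).2 v) = 1 := by
  obtain ⟨hαunit, hlast⟩ := valued_last_eq_one_and_lastRow_le_of_thinTestFun_ne_zero hm hv a k hΦ
  set kG : GL (Fin (n + 1)) (AdeleRing (𝓞 K) K) :=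
    (show GL (Fin (n + 1)) (AdeleRing (𝓞 K) K) from (k : (AdelicGroupData.gl (n + 1) K).Adelic)) with hkG
  set kv : GL (Fin (n + 1)) (v.adicCompletion K) := localComponent v kG with hkv
  set av : Fin (n + 1) → (v.adicCompletion K)ˣ := fun i =>
    Units.map (AdelicGroupData.adeleEval K v : AdeleRing (𝓞 K) K →+* v.adicCompletion K).toMonoidHom (a i)
    with hav
  have hav_coe : ∀ i, ((av i : (v.adicCompletion K)ˣ) : v.adicCompletion K) =
      ((a i : ideleGroup K) : AdeleRing (𝓞 K) K).2 v := fun i => rfl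
  -- the `v`-component of the torus point and the complementary factor
  set tp : GL (Fin (n + 1)) (AdeleRing (𝓞 K) K) := torusPoint (n + 1) K (a, k) with htp
  have htpv : localComponent v tp = glDiagonal (n + 1) (v.adicCompletion K) av * kv := by
    rw [htp, torusPoint, localComponent, map_mul]
    congr 1
    exact map_glDiagonal_aux _ a
  set g' : GL (Fin (n + 1)) (AdeleRing (𝓞 K) K) := tp * GLn.ofLocal (n + 1) K v (localComponent v tp)⁻¹ with hg'
  have hg'1 : localComponent v g' = 1 := localComponent_mul_ofLocal_inv tp
  have hWloc : WhittakerSupport.IsSpreadWhittaker (ψ.adicComponent v) t M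
      (fun h => W (g' * GLn.ofLocal (n + 1) K v h)) := isSpreadWhittaker_ofLocal hWN hW hg'1
  have hcent : ∀ (z : (v.adicCompletion K)ˣ) (h : GL (Fin (n + 1)) (v.adicCompletion K)),
      W (g' * GLn.ofLocal (n + 1) K v h) ≠ 0 →
        W (g' * GLn.ofLocal (n + 1) K v (glDiagonal (n + 1) (v.adicCompletion K) (fun _ => z) * h)) ≠ 0 :=
    fun z h hne => ofLocal_scalar_ne_zero hWZ g' z h hne
  have hne : W (g' * GLn.ofLocal (n + 1) K v (glDiagonal (n + 1) (v.adicCompletion K) av * kv)) ≠ 0 := by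
    rw [← htpv, hg', mul_assoc, ← map_mul, inv_mul_cancel, map_one, mul_one]
    exact hWne
  have hkv1 : kv ∈ valuedCongruenceSubgroup (Fin (n + 1)) (1 : ℤᵐ⁰) := by
    rw [← glInt_adicCompletion_eq]
    exact localComponent_mem_glInt_of_mem_maximalCompactAdelic k.2
  have h := WhittakerSupport.valuation_eq_of_glDiagonal_mul_ne_zero (ψ.adicComponent v) hψv hM₁ hmono
    hgap hWloc hcent hmt av hkv1 hlast hne i
  rw [hav_coe, hav_coe, hαunit] at h
  exact h

end Pointwise

/-! ### The integral consequence -/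

section Integral

open ValuativeRel

variable {n : ℕ} {K : Type} [Field K] [NumberField K]
variable [MeasurableSpace (ideleGroup K)] [BorelSpace (ideleGroup K)]
  [MeasurableSpace (AdelicGroupData.gl (n + 1) K).Adelic]

/-- **Reduction of the thin `T`-integral to the archimedean torus.** Under the hypotheses of
`valued_eq_one_of_torusIntegrand_thin_ne_zero` at EVERY `v ∈ T`, and for `Φ_∞ ≥ 0`,

  `∫⁻_{B({v ∉ T}) × K} (integrand of thinTestFun Φ_∞ T m) ≤ ∫⁻_{B(all finite v) × K} (integrand of standardTestFun Φ_∞)`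

for every `σ` and all measures: on `B({v ∉ T})` the thin integrand vanishes unless `a` is a unit at
every `v ∈ T` too, i.e. `a ∈ B(all finite places)`, where the thin test function is dominated by the
standard one. [folklore] -/
theorem setLIntegral_torusIntegrand_thin_le
    {ψ : AddChar (AdeleRing (𝓞 K) K) Circle} {W : GL (Fin (n + 1)) (AdeleRing (𝓞 K) K) → ℂ}
    (hWN : ∀ (u : ↥(adelicUnipotent (n + 1) K)) (g : GL (Fin (n + 1)) (AdeleRing (𝓞 K) K)),
      W ((u : GL (Fin (n + 1)) (AdeleRing (𝓞 K) K)) * g) = whittakerCharFun ψ u * W g)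
    (hWZ : ∀ (z : ideleGroup K) (g : GL (Fin (n + 1)) (AdeleRing (𝓞 K) K)),
      ‖W (Matrix.GeneralLinearGroup.scalar (Fin (n + 1)) z * g)‖ = ‖W g‖)
    {T : Finset (HeightOneSpectrum (𝓞 K))} {m : ℕ} (hm : 1 ≤ m)
    (hT : ∀ v ∈ T, ∃ (t : Fin (n + 1) → (v.adicCompletion K)ˣ) (M c₀ : ℤ),
      IsSpreadWhittakerAt v ψ t M W ∧
      (∃ x : v.adicCompletion K, Valued.v x ≤ exp (1 - c₀) ∧ ψ.adicComponent v x ≠ 1) ∧ 1 ≤ M ∧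
      (∀ i j : Fin (n + 1), i ≤ j → Valued.v (t j : v.adicCompletion K) ≤ Valued.v (t i : v.adicCompletion K)) ∧
      (∀ i j : Fin (n + 1), (i : ℕ) + 1 = j →
        exp (M - c₀) * Valued.v (t j : v.adicCompletion K) ≤ Valued.v (t i : v.adicCompletion K)) ∧
      exp (-(m : ℤ)) * Valued.v (t 0 : v.adicCompletion K) ≤
        exp (-M) * Valued.v (t (Fin.last n) : v.adicCompletion K))
    {Φinf : (Fin (n + 1) → InfiniteAdeleRing K) → ℝ} (hΦinf : ∀ z, 0 ≤ Φinf z) (σ : ℝ)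
    (νA : Measure (Fin (n + 1) → ideleGroup K)) (νK : Measure ↥(maximalCompactAdelic (n + 1) K)) :
    ∫⁻ p in unitBox {v | v ∉ (↑T : Set (HeightOneSpectrum (𝓞 K)))} ×ˢ Set.univ,
        torusIntegrand (n + 1) K W (thinTestFun (n + 1) K Φinf T m) σ p ∂(νA.prod νK) ≤
      ∫⁻ p in unitBox (Set.univ : Set (HeightOneSpectrum (𝓞 K))) ×ˢ Set.univ,
        torusIntegrand (n + 1) K W (standardTestFun (n + 1) K Φinf) σ p ∂(νA.prod νK) := by
  classical
  set S₁ : Set ((Fin (n + 1) → ideleGroup K) × ↥(maximalCompactAdelic (n + 1) K)) :=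
    unitBox {v | v ∉ (↑T : Set (HeightOneSpectrum (𝓞 K)))} ×ˢ Set.univ with hS₁
  set S₂ : Set ((Fin (n + 1) → ideleGroup K) × ↥(maximalCompactAdelic (n + 1) K)) :=
    unitBox (Set.univ : Set (HeightOneSpectrum (𝓞 K))) ×ˢ Set.univ with hS₂
  have hS₂m : MeasurableSet S₂ := (measurableSet_unitBox _).prod MeasurableSet.univ
  -- pointwise: on `S₁` the thin integrand is dominated by the indicator of `S₂` times the standard one
  have hpt : ∀ p ∈ S₁, torusIntegrand (n + 1) K W (thinTestFun (n + 1) K Φinf T m) σ p ≤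
      S₂.indicator (torusIntegrand (n + 1) K W (standardTestFun (n + 1) K Φinf) σ) p := by
    rintro ⟨a, k⟩ hp
    by_cases hW0 : W (torusPoint (n + 1) K (a, k)) = 0
    · simp only [torusIntegrand, hW0, norm_zero, ne_eq, OfNat.ofNat_ne_zero, not_false_eq_true, zero_pow,
        zero_mul, ENNReal.ofReal_zero]
      exact zero_le
    by_cases hΦ0 : thinTestFun (n + 1) K Φinf T m (lastRow (n + 1) K (torusPoint (n + 1) K (a, k))) = 0
    · simp only [torusIntegrand, hΦ0, mul_zero, zero_mul, ENNReal.ofReal_zero]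
      exact zero_le
    -- both factors are non-zero: `a` is a unit everywhere
    have hunit : a ∈ unitBox (Set.univ : Set (HeightOneSpectrum (𝓞 K))) := by
      intro w _ i
      by_cases hw : w ∈ T
      · obtain ⟨t, M, c₀, hWv, hψv, hM₁, hmono, hgap, hmt⟩ := hT w hw
        exact valued_eq_one_of_torusIntegrand_thin_ne_zero hWN hWZ hWv hψv hM₁ hmono hgap hm hmt hw a k hW0
          hΦ0 i
      · exact hp.1 w hw i
    have hmem : ((a, k) : (Fin (n + 1) → ideleGroup K) × ↥(maximalCompactAdelic (n + 1) K)) ∈ S₂ :=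
      ⟨hunit, Set.mem_univ _⟩
    rw [Set.indicator_of_mem hmem]
    -- and there the two test functions agree (the row is integral)
    have hint : ∀ (i : Fin (n + 1)) (w : HeightOneSpectrum (𝓞 K)),
        (lastRow (n + 1) K (torusPoint (n + 1) K (a, k)) i).2 w ∈ w.adicCompletionIntegers K :=
      fun i w => (HeightOneSpectrum.mem_adicCompletionIntegers (R := 𝓞 K) K w).2
        (thinTestFun_ne_zero_valued_le_one hΦ0 i w)
    have hle : thinTestFun (n + 1) K Φinf T m (lastRow (n + 1) K (torusPoint (n + 1) K (a, k))) ≤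
        standardTestFun (n + 1) K Φinf (lastRow (n + 1) K (torusPoint (n + 1) K (a, k))) := by
      unfold standardTestFun
      rw [if_pos hint]
      exact thinTestFun_le hΦinf T m _
    simp only [torusIntegrand]
    refine ENNReal.ofReal_le_ofReal (mul_le_mul_of_nonneg_right (mul_le_mul_of_nonneg_left hle (sq_nonneg _))
      (torusWeight_nonneg σ a))
  calc ∫⁻ p in S₁, torusIntegrand (n + 1) K W (thinTestFun (n + 1) K Φinf T m) σ p ∂(νA.prod νK)
      ≤ ∫⁻ p in S₁, S₂.indicator (torusIntegrand (n + 1) K W (standardTestFun (n + 1) K Φinf) σ) p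
          ∂(νA.prod νK) := setLIntegral_mono_ae' ?_ ?_
    _ ≤ ∫⁻ p, S₂.indicator (torusIntegrand (n + 1) K W (standardTestFun (n + 1) K Φinf) σ) p ∂(νA.prod νK) :=
          setLIntegral_le_lintegral _ _
    _ = ∫⁻ p in S₂, torusIntegrand (n + 1) K W (standardTestFun (n + 1) K Φinf) σ p ∂(νA.prod νK) :=
          lintegral_indicator hS₂m _
  · exact (measurableSet_unitBox _).prod MeasurableSet.univ
  · exact Filter.Eventually.of_forall hpt

end Integral

end Literature.NumberTheory.Automorphic
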